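import Mathlib
import Literature.NumberTheory.Automorphic.HilbertModularFormQExpansion
import Summits.Langlands.Langlands.Theorems.CapacityClassicalityHilbertIntegralOverconvergentIsCongruenceStubSlashMul
import Summits.Langlands.Langlands.Theorems.CapacityClassicalityHilbertIntegralOverconvergentIsCongruenceStubImaginaryOrthantIdentity

/-!
# Transformation law of the coordinate derivative and of the first Rankin–Cohen bracket
(stub stub_slice_deriv_law of line Sketch-ideate-r1-k1)

Stub X2 of section X of the crux `HilbertIntegralOverconvergentIsCongruence` (stmt-Langlands-8485).
For `f` holomorphic on `ℍ = halfSpace F ⊆ ℂ^{Hom(F,ℝ)}` with `f(γz) = J_k(γ,z) f(z)` on `ℍ`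
(`γ = (a b; c d) ∈ SL₂(F)`), the derivative `∂_σ` in the coordinate `z_σ` — written as the derivative
of the slice `t ↦ f (update z σ t)` at `t = z_σ` — satisfies
`(∂_σ f)(γz) = j² J_k(γ,z) (∂_σ f(z) + k_σ σ(c) j⁻¹ f(z))`, `j = σ(c) z_σ + σ(d)`, and consequently the
first Rankin–Cohen bracket `[f,g]_σ = k_σ f ∂_σ g - l_σ g ∂_σ f` of two such functions of weights `k`,
`l` satisfies the law of weight `k + l + 2e_σ`.

Proof (one-variable calculus along slices): the action is coordinatewise,
`γ(update z σ t) = update (γz) σ (m t)` with the Möbius slice `m t = (σ(a) t + σ(b)) / (σ(c) t + σ(d))`,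
whose derivative at `z_σ` is `j⁻²` (`σ(a)σ(d) - σ(b)σ(c) = 1`), and
`J_k(γ, update z σ t) = (σ(c) t + σ(d))^{k_σ} R` with `R` independent of `t`.  Near `t = z_σ` (where
`Im t > 0`) the law reads `f(update (γz) σ (m t)) = (σ(c) t + σ(d))^{k_σ} R f(update z σ t)`;
differentiating both sides at `z_σ` (chain rule on the left, product rule and
`∂_t (σ(c) t + σ(d))^{k_σ} = k_σ σ(c) j^{k_σ - 1}` on the right) and equating the derivatives gives the
first clause after multiplication by `j²`.  For the bracket one inserts the first clause for `f` and
for `g`, the laws of `f` and `g`, and `J_{k+l+2e_σ} = J_k J_l j²`; the cross terms cancel.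
-/

set_option linter.dupNamespace false

noncomputable section

namespace Summit.Langlands.Langlands.Theorems.HilbertIntegralOverconvergentIsCongruence

open MeasureTheory Complex NumberField
open Literature.NumberTheory.Automorphic Literature.NumberTheory.Automorphic.HilbertModular
open scoped MatrixGroups
open Filter Topology

variable {F : Type} [Field F] [NumberField F]

/-- The slice `t ↦ u (update p σ t)` of a function holomorphic on `ℍ` through `p ∈ ℍ` is
differentiable at `t = p_σ`, where the slice passes through `p` (chain rule with the affine map
`t ↦ update p σ t`). [folklore] -/
theorem sdl_slice_hasDerivAt [DecidableEq (F →+* ℝ)] {u : Point F → ℂ} (hu : IsHolomorphicOn F u)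
    {p : Point F} (hp : p ∈ halfSpace F) (σ : F →+* ℝ) :
    HasDerivAt (fun t : ℂ ↦ u (Function.update p σ t))
      (deriv (fun t : ℂ ↦ u (Function.update p σ t)) (p σ)) (p σ) := by
  have hd : DifferentiableAt ℂ u (Function.update p σ (p σ)) := by
    rw [Function.update_eq_self]
    exact hu.differentiableAt (isOpen_halfSpace.mem_nhds hp)
  exact (hd.comp (p σ) (hasDerivAt_update p σ (p σ)).differentiableAt).hasDerivAt

omit [NumberField F] in
/-- The action of `SL₂(F)` on `ℂ^{Hom(F,ℝ)}` is coordinatewise: moving the `σ`-th coordinate of `z`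
to `t` moves the `σ`-th coordinate of `γz` to `(σ(a) t + σ(b)) / (σ(c) t + σ(d))` and fixes the
others. [folklore] -/
theorem sdl_moeb_update [DecidableEq (F →+* ℝ)] (γ : SL(2, F)) (z : Point F) (σ : F →+* ℝ)
    (t : ℂ) :
    moeb γ (Function.update z σ t) = Function.update (moeb γ z) σ
      (((σ (γ 0 0) : ℂ) * t + (σ (γ 0 1) : ℂ)) / ((σ (γ 1 0) : ℂ) * t + (σ (γ 1 1) : ℂ))) := by
  funext σ'
  rcases eq_or_ne σ' σ with rfl | hne
  · rw [Function.update_self, slm_moeb_apply, denom, Function.update_self]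
  · rw [Function.update_of_ne hne, slm_moeb_apply, slm_moeb_apply, denom, denom,
      Function.update_of_ne hne]

omit [NumberField F] in
/-- The Möbius slice `t ↦ (σ(a) t + σ(b)) / (σ(c) t + σ(d))` of `γ = (a b; c d) ∈ SL₂(F)` has
derivative `(σ(c) z_σ + σ(d))⁻²` at `t = z_σ` for `z ∈ ℍ` (quotient rule and
`σ(a)σ(d) - σ(b)σ(c) = 1`). [folklore] -/
theorem sdl_hasDerivAt_moebSlice (γ : SL(2, F)) {z : Point F} (hz : z ∈ halfSpace F)
    (σ : F →+* ℝ) :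
    HasDerivAt (fun t : ℂ ↦
        ((σ (γ 0 0) : ℂ) * t + (σ (γ 0 1) : ℂ)) / ((σ (γ 1 0) : ℂ) * t + (σ (γ 1 1) : ℂ)))
      (denom γ z σ ^ 2)⁻¹ (z σ) := by
  have hj : denom γ z σ ≠ 0 := denom_ne_zero γ hz σ
  have hnum : HasDerivAt (fun t : ℂ ↦ (σ (γ 0 0) : ℂ) * t + (σ (γ 0 1) : ℂ)) (σ (γ 0 0) : ℂ)
      (z σ) := (hasDerivAt_const_mul _).add_const _
  have hden : HasDerivAt (fun t : ℂ ↦ (σ (γ 1 0) : ℂ) * t + (σ (γ 1 1) : ℂ)) (σ (γ 1 0) : ℂ)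
      (z σ) := (hasDerivAt_const_mul _).add_const _
  refine (hnum.div hden hj).congr_deriv ?_
  have hdet : (σ (γ 0 0) : ℂ) * (σ (γ 1 1) : ℂ) - (σ (γ 0 1) : ℂ) * (σ (γ 1 0) : ℂ) = 1 := by
    exact_mod_cast slm_det_embedding γ σ
  rw [inv_eq_one_div, denom]
  congr 1
  linear_combination hdet

omit [NumberField F] in
/-- The slice `t ↦ (σ(c) t + σ(d))^n` of a power of the denominator of `γ = (a b; c d)` has
derivative `n (σ(c) z_σ + σ(d))^{n-1} σ(c)` at `t = z_σ` for `z ∈ ℍ` (the base does not vanish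
there). [folklore] -/
theorem sdl_hasDerivAt_denom_zpow (γ : SL(2, F)) {z : Point F} (hz : z ∈ halfSpace F)
    (σ : F →+* ℝ) (n : ℤ) :
    HasDerivAt (fun t : ℂ ↦ ((σ (γ 1 0) : ℂ) * t + (σ (γ 1 1) : ℂ)) ^ n)
      ((n : ℂ) * denom γ z σ ^ (n - 1) * (σ (γ 1 0) : ℂ)) (z σ) := by
  have hden : HasDerivAt (fun t : ℂ ↦ (σ (γ 1 0) : ℂ) * t + (σ (γ 1 1) : ℂ)) (σ (γ 1 0) : ℂ)
      (z σ) := (hasDerivAt_const_mul _).add_const _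
  exact (hasDerivAt_zpow n (denom γ z σ) (Or.inl (denom_ne_zero γ hz σ))).comp_of_eq (z σ) hden rfl

/-- The automorphy factor at a point moved in the `σ`-th coordinate:
`J_k(γ, update z σ t) = (σ(c) t + σ(d))^{k_σ} R` with `R = ∏_{σ' ≠ σ} (σ'(c) z_{σ'} + σ'(d))^{k_{σ'}}`
independent of `t`. [folklore] -/
theorem sdl_autFactor_update [DecidableEq (F →+* ℝ)] (k : (F →+* ℝ) → ℤ) (γ : SL(2, F))
    (z : Point F) (σ : F →+* ℝ) (t : ℂ) :
    autFactor k γ (Function.update z σ t) =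
      ((σ (γ 1 0) : ℂ) * t + (σ (γ 1 1) : ℂ)) ^ k σ *
        ∏ σ' ∈ Finset.univ.erase σ, denom γ z σ' ^ k σ' := by
  rw [autFactor, ← Finset.mul_prod_erase Finset.univ _ (Finset.mem_univ σ)]
  congr 1
  · rw [denom, Function.update_self]
  · refine Finset.prod_congr rfl fun σ' hσ' ↦ ?_
    rw [denom, denom, Function.update_of_ne (Finset.ne_of_mem_erase hσ')]

/-- The automorphy factor of the weight `2e_σ` is `(σ(c) z_σ + σ(d))²`. [folklore] -/
theorem sdl_autFactor_single [DecidableEq (F →+* ℝ)] (γ : SL(2, F)) (z : Point F) (σ : F →+* ℝ) :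
    autFactor (Pi.single σ (2 : ℤ)) γ z = denom γ z σ ^ 2 := by
  rw [autFactor, Finset.prod_eq_single σ]
  · rw [Pi.single_eq_same]
    exact zpow_ofNat _ 2
  · intro σ' _ hne
    rw [Pi.single_eq_of_ne hne, zpow_zero]
  · intro h
    exact absurd (Finset.mem_univ σ) h

/-- **The law of the coordinate derivative.** For `f` holomorphic on `ℍ` with
`f(γz) = J_k(γ,z) f(z)` on `ℍ` and `z ∈ ℍ`:
`(∂_σ f)(γz) = j² J_k(γ,z) (∂_σ f(z) + k_σ σ(c) j⁻¹ f(z))`, `j = σ(c) z_σ + σ(d)` (differentiate the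
law along the slice `t ↦ update z σ t` at `t = z_σ` and solve). [folklore] -/
theorem sdl_deriv_law [DecidableEq (F →+* ℝ)] (k : (F →+* ℝ) → ℤ) (σ : F →+* ℝ) {f : Point F → ℂ}
    (hf : IsHolomorphicOn F f) (γ : SL(2, F))
    (hfγ : ∀ z ∈ halfSpace F, f (moeb γ z) = autFactor k γ z * f z) {z : Point F}
    (hz : z ∈ halfSpace F) :
    deriv (fun t : ℂ ↦ f (Function.update (moeb γ z) σ t)) (moeb γ z σ) =
      denom γ z σ ^ 2 * autFactor k γ z *
        (deriv (fun t : ℂ ↦ f (Function.update z σ t)) (z σ) +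
          (k σ : ℂ) * ((σ (γ 1 0) : ℝ) : ℂ) * (denom γ z σ)⁻¹ * f z) := by
  have hγz : moeb γ z ∈ halfSpace F := slm_moeb_mem_halfSpace γ hz
  have hj : denom γ z σ ≠ 0 := denom_ne_zero γ hz σ
  -- the factor `R` of `J_k` off `σ`
  obtain ⟨R, hR⟩ : ∃ R : ℂ, (∏ σ' ∈ Finset.univ.erase σ, denom γ z σ' ^ k σ') = R := ⟨_, rfl⟩
  have hA : autFactor k γ z = denom γ z σ ^ k σ * R := by
    have h := sdl_autFactor_update k γ z σ (z σ)
    rw [Function.update_eq_self, hR] at h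
    exact h
  -- left-hand side: `f` along the slice through `γz`, composed with the Möbius slice
  have hL := (sdl_slice_hasDerivAt hf hγz σ).comp_of_eq (z σ)
    (sdl_hasDerivAt_moebSlice γ hz σ) rfl
  -- right-hand side: `(σ(c) t + σ(d))^{k_σ} R f(update z σ t)`
  have hRHS := ((sdl_hasDerivAt_denom_zpow γ hz σ (k σ)).mul_const R).fun_mul
    (sdl_slice_hasDerivAt hf hz σ)
  -- the two functions agree near `z_σ`
  have hopen : IsOpen {t : ℂ | 0 < t.im} := isOpen_lt continuous_const Complex.continuous_im
  have heq : (fun t : ℂ ↦ ((σ (γ 1 0) : ℂ) * t + (σ (γ 1 1) : ℂ)) ^ k σ * R *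
        f (Function.update z σ t)) =ᶠ[𝓝 (z σ)]
      ((fun t : ℂ ↦ f (Function.update (moeb γ z) σ t)) ∘ fun t : ℂ ↦
        ((σ (γ 0 0) : ℂ) * t + (σ (γ 0 1) : ℂ)) / ((σ (γ 1 0) : ℂ) * t + (σ (γ 1 1) : ℂ))) := by
    filter_upwards [hopen.mem_nhds (hz σ)] with t ht
    have h := hfγ _ (ioi_update_mem_halfSpace hz σ ht)
    rw [sdl_moeb_update, sdl_autFactor_update, hR] at h
    exact h.symm
  have hderiv := hRHS.unique (hL.congr_of_eventuallyEq heq)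
  rw [Function.update_eq_self] at hderiv
  have key : deriv (fun t : ℂ ↦ f (Function.update (moeb γ z) σ t)) (moeb γ z σ) =
      deriv (fun t : ℂ ↦ f (Function.update (moeb γ z) σ t)) (moeb γ z σ) * (denom γ z σ ^ 2)⁻¹ *
        denom γ z σ ^ 2 := (inv_mul_cancel_right₀ (pow_ne_zero 2 hj) _).symm
  rw [← hderiv] at key
  rw [key, hA, zpow_sub_one₀ hj]
  simp only [denom]
  ring

/-- **The law of the first Rankin–Cohen bracket.** For `f`, `g` holomorphic on `ℍ` with the laws of
weights `k`, `l` under `γ`, the bracket `k_σ f ∂_σ g - l_σ g ∂_σ f` satisfies the law of weight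
`k + l + 2e_σ` under `γ` (insert the law of the coordinate derivative; the cross terms cancel).
[folklore] -/
theorem sdl_bracket_law [DecidableEq (F →+* ℝ)] (k l : (F →+* ℝ) → ℤ) (σ : F →+* ℝ)
    {f g : Point F → ℂ} (hf : IsHolomorphicOn F f) (hg : IsHolomorphicOn F g) (γ : SL(2, F))
    (hfγ : ∀ z ∈ halfSpace F, f (moeb γ z) = autFactor k γ z * f z)
    (hgγ : ∀ z ∈ halfSpace F, g (moeb γ z) = autFactor l γ z * g z) {z : Point F}
    (hz : z ∈ halfSpace F) :
    (k σ : ℂ) * f (moeb γ z) * deriv (fun t : ℂ ↦ g (Function.update (moeb γ z) σ t)) (moeb γ z σ) -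
        (l σ : ℂ) * g (moeb γ z) *
          deriv (fun t : ℂ ↦ f (Function.update (moeb γ z) σ t)) (moeb γ z σ) =
      autFactor (k + l + Pi.single σ 2) γ z *
        ((k σ : ℂ) * f z * deriv (fun t : ℂ ↦ g (Function.update z σ t)) (z σ) -
          (l σ : ℂ) * g z * deriv (fun t : ℂ ↦ f (Function.update z σ t)) (z σ)) := by
  rw [sdl_deriv_law k σ hf γ hfγ hz, sdl_deriv_law l σ hg γ hgγ hz, hfγ z hz, hgγ z hz,
    autFactor_add _ _ γ hz, autFactor_add _ _ γ hz, sdl_autFactor_single]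
  ring

open Classical in
/-- **stub X2 — `stub_slice_deriv_law` (L; how `∂_σ` and the first Rankin–Cohen bracket transform).** If `f` is holomorphic on `ℍ`
with `f(γz) = J_k(γ,z) f(z)` on `ℍ` (`γ ∈ SL₂(F)`), then, writing `j_σ = σ(c) z_σ + σ(d)` (`denom γ z σ`),
`(∂_σ f)(γz) = j_σ² J_k(γ,z) (∂_σ f(z) + k_σ σ(c) j_σ⁻¹ f(z))` (differentiate the law along the slice `t ↦ update z σ t`: the action is
coordinatewise, `(γ·)_σ` has derivative `j_σ⁻²`, and `∂_t J_k = k_σ σ(c) j_σ⁻¹ J_k`); consequently for a second such `g` of weight `l`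
the bracket `[f,g]_σ = k_σ f ∂_σ g - l_σ g ∂_σ f` satisfies the law of weight `k + l + 2e_σ` (the cross terms cancel). [folklore] -/
theorem stub_slice_deriv_law (F : Type) [Field F] [NumberField F] (k l : (F →+* ℝ) → ℤ) (σ : F →+* ℝ)
    (f g : Point F → ℂ) (hf : IsHolomorphicOn F f) (hg : IsHolomorphicOn F g) (γ : SL(2, F))
    (hfγ : ∀ z ∈ halfSpace F, f (moeb γ z) = autFactor k γ z * f z)
    (hgγ : ∀ z ∈ halfSpace F, g (moeb γ z) = autFactor l γ z * g z) :
    (∀ z ∈ halfSpace F,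
      deriv (fun t : ℂ ↦ f (Function.update (moeb γ z) σ t)) (moeb γ z σ) =
        denom γ z σ ^ 2 * autFactor k γ z *
          (deriv (fun t : ℂ ↦ f (Function.update z σ t)) (z σ) +
            (k σ : ℂ) * ((σ (γ 1 0) : ℝ) : ℂ) * (denom γ z σ)⁻¹ * f z)) ∧
    ∀ z ∈ halfSpace F,
      (k σ : ℂ) * f (moeb γ z) * deriv (fun t : ℂ ↦ g (Function.update (moeb γ z) σ t)) (moeb γ z σ) -
          (l σ : ℂ) * g (moeb γ z) * deriv (fun t : ℂ ↦ f (Function.update (moeb γ z) σ t)) (moeb γ z σ) =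
        autFactor (k + l + Pi.single σ 2) γ z *
          ((k σ : ℂ) * f z * deriv (fun t : ℂ ↦ g (Function.update z σ t)) (z σ) -
            (l σ : ℂ) * g z * deriv (fun t : ℂ ↦ f (Function.update z σ t)) (z σ)) :=
  ⟨fun _ hz ↦ sdl_deriv_law k σ hf γ hfγ hz, fun _ hz ↦ sdl_bracket_law k l σ hf hg γ hfγ hgγ hz⟩

end Summit.Langlands.Langlands.Theorems.HilbertIntegralOverconvergentIsCongruence
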